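/-
Copyright (c) 2026. All rights reserved.
Released under Apache 2.0 license as described in the file LICENSE.
Authors: abc-iut cell — seat abc-iut-f-060 (block F fact-proving wave; FACT-LIST row F-0207
`CuspidalData.DecompEqCommensuratorOfInertia` of `AbsTopIChains.lean` at the surface-group model).
-/
import Literature.AnabelianGeometry.AbsoluteAnabelian.AbsTopIChainsCuspidalFacts
import Literature.AnabelianGeometry.AbsoluteAnabelian.AbsAnabFundamentalGroupsModelProofs
import HarnessLib

/-!
# [AbsTopI] Lemma 4.5 (vi) AT THE SURFACE-GROUP MODEL: `D_x = C_Π(D_x ∩ Δ)` iff `D_x = N_Π(D_x ∩ Δ)`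

S. Mochizuki, *Topics in Absolute Anabelian Geometry I: Generalities* [MochizukiAbsTopI2012], Lemma 4.5 (vi)
p. 55: "Let `I ⊆ Π` be a decomposition group of a cusp. Then `I = C_Π(I ∩ Δ)`"; the printed proof (p. 55
l. 17–19) is "(v), (vi) follow immediately from [Mzk12], Proposition 1.2, (i), (ii)" — i.e. from the
commensurable terminality of the cusp inertia subgroups `I ∩ Δ ⊆ Δ` ([CombGC] Prop. 1.2 (ii); for curves
[AbsAnab] Lemma 1.3.7, the cell's FACT-LIST row F-0003 `CuspidalData.InertiaCommensurablyTerminal`).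

PROOF-ONLY composition (no `def` / `instance` / `structure`) of two landed files:

* abc-iut-f-060's STRUCTURE THEOREM `CuspidalData.decompEqCommensuratorOfInertia_iff`
  (`AbsTopIChainsCuspidalFacts.lean`): for every cuspidal datum, (vi) ⟺ F-0003 ∧ `DecompEqNormalizer`
  (`D_x = N_Π(I_x)`, [AbsTopIII] Thm 1.11 (b) as typed, F-0405);
* abc-iut-f-051's MODEL INSTANCE `CuspidalData.inertiaCommensurablyTerminal_of_isProSigmaCompletion`
  (`AbsAnabFundamentalGroupsModelProofs.lean`): F-0003 HOLDS for every extension whose `Δ` is a pro-`Σ`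
  completion `ι : Γ_{g,r} → Δ` of a hyperbolic punctured surface group and every cuspidal datum whose
  inertia groups are the closed cusp-inertia subgroups `closure ι⟨c_{j(x)}⟩` of the presentation.

Result (`CuspidalData.decompEqCommensuratorOfInertia_iff_decompEqNormalizer_of_isProSigmaCompletion`):
AT THAT MODEL, row F-0207 ([AbsTopI] Lemma 4.5 (vi) as typed) is EQUIVALENT to row F-0405 (`D_x = N_Π(I_x)`)
— the printed reduction of (vi) to [CombGC] Prop. 1.2 (ii), kernel-checked: once the inertia groups are the
genuine cusp inertia of a surface group, "`D_x` is the commensurator of `I_x`" says neither more nor less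
than "`D_x` is the normaliser of `I_x`", which is how [AbsTopIII] Thm 1.11 (b) p. 46 CONSTRUCTS `D_x`
("the decomposition group `D_x` … may then be constructed as the normalizer … of `I_x`").  In particular
(vi) HOLDS at the model for every cuspidal datum with `D_x := N_Π(closure ι⟨c_{j(x)}⟩)`
(`CuspidalData.decompEqCommensuratorOfInertia_of_isProSigmaCompletion`).

HONEST SCOPE: a MODEL-level instance form of an R5 schema row (FACT-LIST class «universal-closure
REFUTED; instance form PROVED/REDUCED at the model»); `Δ` is presented abstractly as a pro-`Σ` surface-group
completion (the étale `π₁` of a curve is not constructed); classical anabelian preliminaries — nothing here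
bears on [IUTchIII] Cor. 3.12 or takes a side; typed ≠ proved elsewhere.
-/

noncomputable section

namespace Literature.AnabelianGeometry.AbsoluteAnabelian.FundamentalExtension

open Literature.AnabelianGeometry.SemiGraphs
open Literature.AnabelianGeometry.SemiGraphs.SemiGraphOfAnabelioids
open Literature.GroupTheory.CombinatorialGroupTheory

universe u

variable {Sigma : Set ℕ} {g r : ℕ}

/-- **[AbsTopI] Lemma 4.5 (vi) ⟺ [AbsTopIII] Thm 1.11 (b) at the surface-group model** (F-0207 ⟺ F-0405):
for an extension whose `Δ` is a pro-`Σ` completion `ι : Γ_{g,r} → Δ` of a hyperbolic punctured surface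
group (`Σ` a nonempty set of primes) and cuspidal data whose inertia groups in `Δ` are the closed
cusp-inertia subgroups `closure ι⟨c_{j(x)}⟩`, every decomposition group is the COMMENSURATOR of its
inertia group iff every decomposition group is the NORMALISER of its inertia group — [AbsAnab] Lemma
1.3.7 at the model (abc-iut-f-051) fed into the structure theorem of (vi).
[cite: MochizukiAbsTopI2012, Lemma 4.5 (vi) p.55] -/
theorem CuspidalData.decompEqCommensuratorOfInertia_iff_decompEqNormalizer_of_isProSigmaCompletion
    {E : FundamentalExtension.{u}} (C : CuspidalData E)
    (hS : Sigma.Nonempty) (hSp : ∀ p ∈ Sigma, p.Prime)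
    (hgr : PuncturedSurfaceGroup.IsHyperbolicType g r)
    (ι : PuncturedSurfaceGroup g r →* E.geom) (hι : IsProSigmaCompletion Sigma ι)
    (j : C.Cusp → Fin r)
    (hI : ∀ x, (C.Icusp x).subgroupOf E.geom =
      ((PuncturedSurfaceGroup.cuspInertia (g := g) (j x)).map ι).topologicalClosure) :
    C.DecompEqCommensuratorOfInertia ↔ C.DecompEqNormalizer := by
  have h137 : C.InertiaCommensurablyTerminal :=
    C.inertiaCommensurablyTerminal_of_isProSigmaCompletion hS hSp hgr ι hι j hI
  rw [C.decompEqCommensuratorOfInertia_iff]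
  exact ⟨fun h => h.2, fun h => ⟨h137, h⟩⟩

/-- **F-0207 at the surface-group model**: with `Δ`, `ι`, `Σ` and the inertia groups as above, if each
decomposition group `D_x` is the normaliser `N_Π(I_x)` of its inertia group (the construction of
[AbsTopIII] Thm 1.11 (b)), then `D_x = C_Π(D_x ∩ Δ)` for every cusp — [AbsTopI] Lemma 4.5 (vi) as typed
HOLDS at the model. [cite: MochizukiAbsTopI2012, Lemma 4.5 (vi) p.55] -/
theorem CuspidalData.decompEqCommensuratorOfInertia_of_isProSigmaCompletion
    {E : FundamentalExtension.{u}} (C : CuspidalData E)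
    (hS : Sigma.Nonempty) (hSp : ∀ p ∈ Sigma, p.Prime)
    (hgr : PuncturedSurfaceGroup.IsHyperbolicType g r)
    (ι : PuncturedSurfaceGroup g r →* E.geom) (hι : IsProSigmaCompletion Sigma ι)
    (j : C.Cusp → Fin r)
    (hI : ∀ x, (C.Icusp x).subgroupOf E.geom =
      ((PuncturedSurfaceGroup.cuspInertia (g := g) (j x)).map ι).topologicalClosure)
    (hD : C.DecompEqNormalizer) : C.DecompEqCommensuratorOfInertia :=
  (C.decompEqCommensuratorOfInertia_iff_decompEqNormalizer_of_isProSigmaCompletion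
    hS hSp hgr ι hι j hI).mpr hD

end Literature.AnabelianGeometry.AbsoluteAnabelian.FundamentalExtension

end
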